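import Mathlib.Combinatorics.Hall.Basic
import Mathlib.Data.Finset.Card
import HarnessLib

/-!
# `NoHeavyLowerTail` (crux stmt-CriticalPhenomena-4575), hull-port line hp-7: the EXPORT STEP of the J-BERN⁺ matching problem is free

Support file (prover `prim-hp-7`, generation 46; `--supports stmt-CriticalPhenomena-4575`).  Pure finite combinatorics, no definitions,
no `sorry`, standard axioms.

THE MATHEMATICS (memo `prim-hp-7/FROM-prim-hp-7-g46-EXPORTS-FREE.md` §2, THEOREM X).  J-BERN⁺ asks for a perfect matching of sources
`NEG′` to targets `POS′ = t ⊔ x` along the relation "code of the source ≤ code of the target".  The `x`-targets ("exports") with a given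
third copy `Z` all carry the code of `Z`, and so do the `(T,PM,PM)`-sources with third copy `Z`, of which there are at least as many
(frame-free DOM0, `JBern.card_sdiff_inter_compls_sdiff_le`).  Hence one may reserve, class by class, a set `D` of sources and a
code-preserving bijection `e : D → x`.  The abstract content of THEOREM X is then: Hall's condition for `NEG′ → t ⊔ x` is EQUIVALENT to
Hall's condition for the residual problem `NEG′ \ D → t` — because `D` and `x` contribute the same amount to both sides of every Hall
inequality.  So the normal form "exports keep the third copy" is without loss of generality, and J-BERN⁺ is equivalent to the residual
(transport) statement (H′) of the memo.
* `card_le_card_filter_sdiff_of_hall` : Hall for all sources and all targets ⇒ Hall for the sources outside `D` into the targets outside `e '' D`;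
* `hall_of_card_le_card_filter_sdiff` : the converse;
* `exists_injOn_sdiff_of_hall` : hence (Hall's marriage theorem) a code-monotone injection of the residual sources into the residual targets. [this work]
-/

namespace Summit.CriticalPhenomena.PercolationContinuityZ3.Theorems.JBern

open Finset Function

variable {ι κ β : Type*} [DecidableEq ι] [DecidableEq κ] [Fintype ι] [Fintype κ] [Preorder β]
  [DecidableRel (fun b b' : β => b ≤ b')]

/-- **Exports are free (Hall ⇒ residual Hall).**  Sources `ι` with codes `f`, targets `κ` with codes `g`, admissible pairs `f a ≤ g b`.
Let `D` be a set of sources and `e` a map, injective on `D`, matching each `d ∈ D` to a target with an equivalent code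
(`f d ≤ g (e d)` and `g (e d) ≤ f d`).  If Hall's condition holds for all sources into all targets, then it holds for the sources
disjoint from `D` into the targets outside `D.image e`. [this work] -/
theorem card_le_card_filter_sdiff_of_hall (f : ι → β) (g : κ → β) (D : Finset ι) (e : ι → κ)
    (he : Set.InjOn e D) (hcode : ∀ d ∈ D, f d ≤ g (e d) ∧ g (e d) ≤ f d)
    (hall : ∀ A : Finset ι, #A ≤ #(univ.filter fun b => ∃ a ∈ A, f a ≤ g b))
    (A : Finset ι) (hA : Disjoint A D) :
    #A ≤ #((univ \ D.image e).filter fun b => ∃ a ∈ A, f a ≤ g b) := by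
  classical
  -- enlarge `A` by the sources of `D` whose code lies above the code of some element of `A`
  set DA : Finset ι := D.filter (fun d => ∃ a ∈ A, f a ≤ f d) with hDA
  have hsub : DA ⊆ D := filter_subset _ _
  have hdisj : Disjoint A DA := hA.mono_right hsub
  have h1 : #(A ∪ DA) = #A + #DA := card_union_of_disjoint hdisj
  -- the neighbourhood of `A ∪ DA` equals the neighbourhood `N` of `A`
  set N : Finset κ := univ.filter (fun b => ∃ a ∈ A, f a ≤ g b) with hN
  have hnbhd : (univ.filter fun b => ∃ a ∈ A ∪ DA, f a ≤ g b) = N := by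
    ext b
    simp only [hN, mem_filter, mem_univ, true_and, mem_union]
    constructor
    · rintro ⟨a, ha | ha, hab⟩
      · exact ⟨a, ha, hab⟩
      · rw [hDA, mem_filter] at ha
        obtain ⟨a', ha', hle⟩ := ha.2
        exact ⟨a', ha', hle.trans hab⟩
    · rintro ⟨a, ha, hab⟩
      exact ⟨a, Or.inl ha, hab⟩
  have h2 : #A + #DA ≤ #N := by rw [← h1, ← hnbhd]; exact hall (A ∪ DA)
  -- split `N` into its parts inside and outside `D.image e`
  have h3 : #N = #(N ∩ D.image e) + #(N \ D.image e) := by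
    rw [← card_inter_add_card_sdiff N (D.image e)]
  -- the part inside `D.image e` is the image of `DA`
  have h4 : N ∩ D.image e = DA.image e := by
    ext b
    simp only [mem_inter, hN, mem_filter, mem_univ, true_and, mem_image, hDA]
    constructor
    · rintro ⟨⟨a, ha, hab⟩, d, hd, rfl⟩
      exact ⟨d, ⟨hd, a, ha, hab.trans (hcode d hd).2⟩, rfl⟩
    · rintro ⟨d, ⟨hd, a, ha, hle⟩, rfl⟩
      exact ⟨⟨a, ha, hle.trans (hcode d hd).1⟩, d, hd, rfl⟩
  have h5 : #(DA.image e) = #DA := card_image_of_injOn (he.mono (by exact_mod_cast hsub))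
  have h6 : N \ D.image e = (univ \ D.image e).filter (fun b => ∃ a ∈ A, f a ≤ g b) := by
    ext b
    simp only [mem_sdiff, hN, mem_filter, mem_univ, true_and]
    tauto
  rw [h3, h4, h5] at h2
  rw [← h6]
  omega

/-- **Residual Hall ⇒ Hall** (the converse of `card_le_card_filter_sdiff_of_hall`): if Hall's condition holds for the sources disjoint from
`D` into the targets outside `D.image e`, then it holds for all sources into all targets (the `D`-part of a source set is served by `e`). [this work] -/
theorem hall_of_card_le_card_filter_sdiff (f : ι → β) (g : κ → β) (D : Finset ι) (e : ι → κ)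
    (he : Set.InjOn e D) (hcode : ∀ d ∈ D, f d ≤ g (e d) ∧ g (e d) ≤ f d)
    (hres : ∀ A : Finset ι, Disjoint A D → #A ≤ #((univ \ D.image e).filter fun b => ∃ a ∈ A, f a ≤ g b))
    (A : Finset ι) : #A ≤ #(univ.filter fun b => ∃ a ∈ A, f a ≤ g b) := by
  classical
  have hsplit : #A = #(A \ D) + #(A ∩ D) := by
    rw [add_comm, card_inter_add_card_sdiff]
  have hr := hres (A \ D) disjoint_sdiff_self_left
  have hi : #((A ∩ D).image e) = #(A ∩ D) := card_image_of_injOn (he.mono (by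
    intro d hd; exact (mem_inter.1 (by exact_mod_cast hd)).2))
  -- the two parts of the neighbourhood are disjoint subsets of the neighbourhood of `A`
  have hsub1 : (univ \ D.image e).filter (fun b => ∃ a ∈ A \ D, f a ≤ g b) ⊆ univ.filter (fun b => ∃ a ∈ A, f a ≤ g b) := by
    intro b hb
    simp only [mem_filter, mem_sdiff, mem_univ, true_and] at hb ⊢
    obtain ⟨a, ha, hab⟩ := hb.2
    exact ⟨a, ha.1, hab⟩
  have hsub2 : (A ∩ D).image e ⊆ univ.filter (fun b => ∃ a ∈ A, f a ≤ g b) := by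
    intro b hb
    simp only [mem_image, mem_inter] at hb
    obtain ⟨d, ⟨hdA, hdD⟩, rfl⟩ := hb
    simp only [mem_filter, mem_univ, true_and]
    exact ⟨d, hdA, (hcode d hdD).1⟩
  have hdisj : Disjoint ((univ \ D.image e).filter (fun b => ∃ a ∈ A \ D, f a ≤ g b)) ((A ∩ D).image e) := by
    rw [disjoint_left]
    intro b hb hb'
    simp only [mem_filter, mem_sdiff, mem_univ, true_and, mem_image, mem_inter] at hb hb'
    obtain ⟨d, ⟨-, hdD⟩, rfl⟩ := hb'
    exact hb.1 ⟨d, hdD, rfl⟩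
  have := card_le_card (union_subset hsub1 hsub2)
  rw [card_union_of_disjoint hdisj, hi] at this
  omega

/-- **Residual matching.**  Under the hypotheses of `card_le_card_filter_sdiff_of_hall` there is a map from the sources outside `D` to the
targets, injective, avoiding `D.image e`, and code-monotone (Hall's marriage theorem applied to the residual Hall condition).  Together with
`e` on `D` this is a perfect-on-sources code-monotone matching in which the reserved pairs `(d, e d)` are kept — the normal form
"exports keep the third copy" of the memo. [this work] -/
theorem exists_injOn_sdiff_of_hall (f : ι → β) (g : κ → β) (D : Finset ι) (e : ι → κ)
    (he : Set.InjOn e D) (hcode : ∀ d ∈ D, f d ≤ g (e d) ∧ g (e d) ≤ f d)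
    (hall : ∀ A : Finset ι, #A ≤ #(univ.filter fun b => ∃ a ∈ A, f a ≤ g b)) :
    ∃ ψ : (↑(univ \ D : Finset ι) : Set ι) → (↑(univ \ D.image e : Finset κ) : Set κ),
      Injective ψ ∧ ∀ a, f a.1 ≤ g (ψ a).1 := by
  classical
  have hallS : ∀ A : Finset (↑(univ \ D : Finset ι) : Set ι),
      #A ≤ #({b : (↑(univ \ D.image e : Finset κ) : Set κ) | ∃ a ∈ A, f a.1 ≤ g b.1} : Finset _) := by
    intro A
    have hA'D : Disjoint (A.map (Embedding.subtype _)) D := by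
      rw [disjoint_left]
      intro a ha haD
      rw [mem_map] at ha
      obtain ⟨a0, -, rfl⟩ := ha
      exact (mem_sdiff.1 a0.2).2 haD
    have h1 : #A = #(A.map (Embedding.subtype _)) := (card_map _).symm
    have h2 := card_le_card_filter_sdiff_of_hall f g D e he hcode hall (A.map (Embedding.subtype _)) hA'D
    have h3 : #((univ \ D.image e).filter fun b => ∃ a ∈ A.map (Embedding.subtype _), f a ≤ g b) ≤
        #({b : (↑(univ \ D.image e : Finset κ) : Set κ) | ∃ a ∈ A, f a.1 ≤ g b.1} : Finset _) := by
      have himg : ((univ \ D.image e).filter fun b => ∃ a ∈ A.map (Embedding.subtype _), f a ≤ g b) ⊆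
          ({b : (↑(univ \ D.image e : Finset κ) : Set κ) | ∃ a ∈ A, f a.1 ≤ g b.1} : Finset _).map (Embedding.subtype _) := by
        intro b hb
        rw [mem_filter] at hb
        rw [mem_map]
        refine ⟨⟨b, hb.1⟩, ?_, rfl⟩
        rw [mem_filter]
        obtain ⟨a, ha, hab⟩ := hb.2
        rw [mem_map] at ha
        obtain ⟨a0, ha0, rfl⟩ := ha
        exact ⟨mem_univ _, a0, ha0, hab⟩
      simpa using card_le_card himg
    rw [h1]; exact h2.trans h3
  obtain ⟨ψ, hinj, hψ⟩ := (Fintype.all_card_le_filter_rel_iff_exists_injective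
    (fun (a : (↑(univ \ D : Finset ι) : Set ι)) (b : (↑(univ \ D.image e : Finset κ) : Set κ)) => f a.1 ≤ g b.1)).1 hallS
  exact ⟨ψ, hinj, hψ⟩

end Summit.CriticalPhenomena.PercolationContinuityZ3.Theorems.JBern
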